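import Summits.QuantumFields.YangMills.Theorems.BalabanUVNodesN15KingModelGraphTreeDecayLetters
import Summits.QuantumFields.YangMills.Theorems.BalabanUVNodesN15KingModelGraphPowerCountingKingR

/-!
# BalabanUVNodes ∕ N15 — THE KING-MODEL RUNG (PART Α-d): THE EXPONENTIAL TREE DECAY OF (3.56) BY NAME AT `A = 0` — the two halves of Proposition 3.6's
# proof WITH «A SMALL PART OF EACH PROPAGATOR» EXTRACTED: the `S^c` terms of the fine graph (part Γ-h's `king_graph_finest_small_R`) and the replacement
# step (part Η-c's `king_graph_replacement_zeroField`), each times the weight bound `Θ₀` of the placement-wise decay weights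
# (Track A, DAG node N15 = NE2; FAN-OUT v1.1 §N15 s3 «KING-MODEL RUNG … NE2's analogue DECIDED in the model»)

HONEST FRAMING.  Count-neutral (cell `pub-ymgap`, seat `pub-ymgap-dag-n15-e` g29; `--supports stmt-QuantumFields-27366 --as helper` = K3⁸
`SpineGivenEndpointR13SepCoPHV`).  TEMPLATE LITERATURE: C. King, *The U(1) Higgs model. I. The continuum limit*, Commun. Math. Phys. **102** (1986) 649–677
[King1986], Proposition 3.6 (3.56) p. 662 and its proof pp. 663–665, for KING's OWN `A = 0` MODEL on the rung's tori `Tor (fine (L^K) (kingVol L j))`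
(volumes `2L^m`, odd `L ≥ 3`, masses `0 < m² ≤ m₀²`): Prop. 3.7 ∕ 3.9 BY NAME (parts Ρ ∕ Χ ∕ Ω₂ `king_props37_38_39_commonConstants`).  NOT Bałaban's
non-abelian `G(U)` of [B9]; NOT a node discharge; nothing continuum ∕ ℝ⁴ ∕ OS ∕ mass-gap ∕ Clay.  0 `sorry`; standard axioms.  Text layer of pp. 662–665
(`paper:king1986-cmp102-king-u1-higgs-i` p0014–p0017) re-read by this seat 2026-08-29.

THE PRINT.  p. 664 [PDF 16], verbatim: *«Consider first a term on the right-hand side of (3.61) with S^c non-empty. We get an upper bound for this expression by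
replacing every propagator by the bounds given in Proposition 3.7 and Theorem 3.3 … By extracting a small part of each propagator, we get the exponential decay
on the right-hand side of (3.56). … So we reduce to the case with S^c empty, i.e. we must bound |E^{(k)}(H) − E^{(k+n)}(H)|. This is done by replacing one by
one every factor in E^{(k+n)}(H) by the corresponding factor in E^{(k)}(H), and bounding the error at each step.»*

READING (declared; ours).  Parts Γ-e∕Γ-h (the `S^c` terms) and Η-c (the replacement step) WITHOUT the extracted decay are the tree's; here the SAME two
statements carry, for any `0 ≤ δ ≤ δ₀∕2` and any nonnegative weights `ϑ_υ` on the one-vertex factors (read on the coarse torus, through King's pairing for the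
fine graph), the factor `Θ₀` bounding `Π_ℓ exp[−δ|x_ℓ − y_ℓ|]·Π_υ ϑ_υ` at every coarse placement — part Α-b makes `Θ₀ = exp[−δ·treeLength]` for a connected
graph, part Α-e assembles (3.56).  The price of halving `δ₀`: (3.68)'s constant becomes `c368 d (δ₀∕2)`, Prop. 3.7's `C` becomes `C e^{δ₀∕2}` on the fine
slices (pairing defect, part Α-c) — constants only.

WHAT THIS FILE PROVES (namespace `Summit.QuantumFields.YangMills.BalabanUVNodes.N15KingModelRung.Curved`).
* §1 ★★ **`king_graph_finest_small_decay_R`** — part Γ-h's `king_graph_finest_small_R` × `Θ₀`: for the `(K+n)`-run's slice-assigned graph values with SOME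
  line finer than the coarse spacing, one-vertex factors bounded by stripped majorants `pu_υ` times weights `ϑ_υ(pt x′)`, and the weight bound `Θ₀` at every
  coarse placement: `Σ_{j′ : S^c ≠ ∅} |E^{(K+n)}(H(j′))| ≤ Θ₀·L^{−γ(K+1)}·Γ·C₁^m·C₂^{nn}·(Σ_π degConst …)·Π qq` with `C e^{δ₀∕2} ≤ C₁`, `c368 d (δ₀∕2) ≤ C₂`.
* §2 ★★★ **`king_graph_replacement_zeroField_decay`** — part Η-c's `king_graph_replacement_zeroField` × `Θ₀`, BY NAME at `A = 0`: one `(C, δ₁, γ)` per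
  Hölder exponent (`δ₁` = half of Props. 3.7∕3.9's common `δ₀`) such that for every mass, volume, `K ≥ 1`, `n ≥ 1`, graph shape, `0 ≤ δ ≤ δ₁`, stripped
  one-vertex data against positive weights, and weight bound `Θ₀`:
  `|E^{(K+n)}(H(j)) − E^{(K)}(H(j))| ≤ Θ₀·(L^{−γK}·Σ_ℓ 𝔼^{(K)}_{C,δ₁}(H(j); ℓ lowered by γ; p) + Σ_υ 𝔼^{(K)}_{C,δ₁}(H(j); p[υ ↦ q_υ]))`.

HONEST SCOPE.  (a) King's `A = 0` model; the two halves only — the assembly over the slice assignments with the degrees' positivity (a HYPOTHESIS) is part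
Α-e's.  (b) Weights: `exp[−δ·|x − y|]` with `|x − y| = tdistT∕L^K` (unit-block units) on the internal lines; arbitrary nonnegative (§1) ∕ positive (§2) `ϑ_υ`
on the one-vertex factors.  (c) NOT Bałaban's `G(U)`; NE2 ∕ N15 untouched.  Locators: [King1986] Prop. 3.6 (3.56) p.662, (3.60)–(3.61) p.663, p.664 («S^c
non-empty … By extracting a small part …»), pp.664–665 (replacement), Prop. 3.7 (3.63) p.663, Prop. 3.9 (3.73) p.665.
-/

noncomputable section

namespace Summit.QuantumFields.YangMills.BalabanUVNodes.N15KingModelRung.Curved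

open scoped BigOperators
open Finset
open Literature.MathematicalPhysics.QuantumFieldTheory.Balaban1983to89.B5Prop11Plancherel (Tor fine)
open Literature.MathematicalPhysics.QuantumFieldTheory.King1986.Torus (tdistT tdistT_nonneg)
open Literature.MathematicalPhysics.QuantumFieldTheory.King1986.SlicePropagator (SliceKernels TwoSpacing Prop37PrintedAt Prop39PrintedAt)
open Literature.MathematicalPhysics.QuantumFieldTheory.King1986.ContinuumLimit (eps)
open Summit.QuantumFields.YangMills.BalabanUVNodes.N15KingModelRung (KingVolIndex kingVol kingVol_neZero)
open Summit.QuantumFields.YangMills.BalabanUVNodes.N15KingModelRung.Graph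

variable {d : ℕ} (L : ℕ) [NeZero L]

/-! ## §1 The `S^c` terms with the decay extracted -/

section PartA

/-- ★★ **«(3.70) GIVES L^{−γk}» WITH «A SMALL PART OF EACH PROPAGATOR» EXTRACTED** (part Γ-h's `king_graph_finest_small_R` × `Θ₀`): for the `(K+n)`-run's
graph values `E^{(K+n)}(H(j′))` (King's `A = 0` slices on the lines, Prop. 3.7 «Furthermore» by name as `h37′`), one-vertex factors `|u′_υ(x′)| ≤ pu_υ(x′)·
ϑ_υ(pt x′)` with nonnegative stripped majorants `pu_υ` (a root-placed `L¹` one, sups `qq_υ` elsewhere) and nonnegative weights `ϑ_υ` on the coarse torus, a rate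
`0 ≤ δ ≤ δ₀∕2`, and the weight bound `Π_ℓ exp[−δ|x_ℓ − y_ℓ|]·Π_υ ϑ_υ ≤ Θ₀` at EVERY coarse placement: the sum over the assignments with some line finer than
the coarse spacing of `|E^{(K+n)}(H(j′))|` is at most `Θ₀·L^{−γ(K+1)}·Γ·C₁^m·C₂^{nn}·(Σ_π degConst(finest-lowered list))·Π qq`, `C e^{δ₀∕2} ≤ C₁`,
`c368 d (δ₀∕2) ≤ C₂` — part Α-a `abs_graphValLS_le_of_weight` termwise (weights read through the pairing), then part Γ-g `sum_graphValLS_slices_lt_le_R` on the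
stripped majorants of part Α-c. [cite: King1986, (3.60)–(3.61) p.663, (3.70) p.664, p.664 («By extracting a small part of each propagator …»)] -/
theorem king_graph_finest_small_decay_R (hL : 2 ≤ L) {a msq : ℝ} {K n eM : ℕ} (hK : 1 ≤ K) (hn : 1 ≤ n) (M : Fin (d + 1) → ℕ) [∀ μ, NeZero (M μ)]
    (hM : ∀ μ, M μ = 2 * L ^ eM) {α C δ₀ C₁ C₂ δ : ℝ} (hC : 0 ≤ C) (hδ₀ : 0 < δ₀) (hδ : 0 ≤ δ) (hδ2 : δ ≤ δ₀ / 2)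
    (hC₁ : C * Real.exp (δ₀ / 2) ≤ C₁) (hC₂ : c368 d (δ₀ / 2) ≤ C₂)
    (h37' : Prop37PrintedAt α (kingSliceKernels L (K + n) eM M hM (one_le_add_of_one_le hK n) a msq) C δ₀)
    {nn m : ℕ} (src tgt : Fin m → Fin (nn + 1)) (κ : Fin m → Option (Fin (d + 1))) {Υ : Type*} [Fintype Υ] [DecidableEq Υ]
    (vtx : Υ → Fin (nn + 1)) (u' : Υ → Tor (fine (L ^ (K + n)) M) → ℝ) (ϑ : Υ → Tor (fine (L ^ K) M) → ℝ) (hϑ : ∀ υ x, 0 ≤ ϑ υ x)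
    (pu : Υ → Tor (fine (L ^ (K + n)) M) → ℝ) (hpu0 : ∀ υ x', 0 ≤ pu υ x')
    (hu' : ∀ υ x', |u' υ x'| ≤ pu υ x' * ϑ υ (kingSlicePt L K n M x'))
    (qq : Υ → ℝ) (υ₀ : Υ) (hυ₀ : vtx υ₀ = 0) (hpq : ∀ υ, υ ≠ υ₀ → ∀ x', pu υ x' ≤ qq υ)
    {Γ : ℝ} (hΓ : ∑ x', (((L : ℝ) ^ (K + n))⁻¹) ^ (d + 1) * pu υ₀ x' ≤ Γ) {Θ₀ : ℝ}
    (hΘ : ∀ σ : Fin (nn + 1) → Tor (fine (L ^ K) M),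
      (∏ ℓ, Real.exp (-(δ * (tdistT (fine (L ^ K) M) (σ (src ℓ)) (σ (tgt ℓ)) / (L : ℝ) ^ K)))) * ∏ υ, ϑ υ (σ (vtx υ)) ≤ Θ₀)
    (cert : Equiv.Perm (Fin m) → ForestCertR nn src tgt) {γ : ℝ} (hγ : 0 ≤ γ)
    (hpos : ∀ π, PosDegrees (List.ofFn fun p : Fin m =>
      lowerFinest γ (orderExps ((d + 1 : ℕ) : ℝ) (fun ℓ => lineExp (d + 1) (κ ℓ)) π (cert π).F) (Fin.rev p))) :
    ∑ j' : Fin m → Fin (K + n), (if ∃ ℓ, ((j' ℓ : ℕ)) < n then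
        |graphValLS ((((L : ℝ) ^ (K + n))⁻¹) ^ (d + 1)) src tgt
          (fun ℓ (x' y' : Tor (fine (L ^ (K + n)) M)) =>
            sliceLine (kingSliceKernels L (K + n) eM M hM (one_le_add_of_one_le hK n) a msq) (j' ℓ) (κ ℓ) x' y') vtx u'| else 0)
      ≤ Θ₀ * ((L : ℝ) ^ (-(γ * (K + 1 : ℕ))) * (Γ * (C₁ ^ m * C₂ ^ nn
          * (∑ π : Equiv.Perm (Fin m), degConst L (List.ofFn fun p : Fin m =>
              lowerFinest γ (orderExps ((d + 1 : ℕ) : ℝ) (fun ℓ => lineExp (d + 1) (κ ℓ)) π (cert π).F) (Fin.rev p)))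
          * ∏ υ ∈ univ.erase υ₀, qq υ))) := by
  have hL1 : 1 ≤ L := by omega
  have hL0 : (0 : ℝ) < L := by exact_mod_cast (show 0 < L by omega)
  have hw0 : (0 : ℝ) ≤ (((L : ℝ) ^ (K + n))⁻¹) ^ (d + 1) := by positivity
  haveI : Nonempty (Tor (fine (L ^ (K + n)) M)) := ⟨fun _ => 0⟩
  have hCe0 : 0 ≤ C * Real.exp (δ₀ / 2) := mul_nonneg hC (Real.exp_nonneg _)
  have hC₁0 : 0 ≤ C₁ := hCe0.trans hC₁
  have hδh : 0 < δ₀ / 2 := by linarith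
  have hC₂0 : 0 ≤ C₂ := (c368_pos d hδh).le.trans hC₂
  have hs0 : ∀ (c : Fin (K + n)) (ex : ℝ), 0 ≤ ((L : ℝ) ^ ((c : ℕ)) * eps L (K + n)) ^ ex := fun c ex =>
    Real.rpow_nonneg (by unfold eps; positivity) _
  -- Θ₀ is nonnegative (weights are)
  have hΘ0 : 0 ≤ Θ₀ := le_trans (mul_nonneg (prod_nonneg fun ℓ _ => Real.exp_nonneg _) (prod_nonneg fun υ _ => hϑ _ _)) (hΘ fun _ => 0)
  -- the stripped majorant family: `|slice|·exp[+δ|pt x′ − pt y′|]`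
  set X : Fin m → Fin (K + n) → Tor (fine (L ^ (K + n)) M) → Tor (fine (L ^ (K + n)) M) → ℝ := fun ℓ c x' y' =>
    |sliceLine (kingSliceKernels L (K + n) eM M hM (one_le_add_of_one_le hK n) a msq) c (κ ℓ) x' y'|
      * Real.exp (δ * (tdistT (fine (L ^ K) M) (kingSlicePt L K n M x') (kingSlicePt L K n M y') / (L : ℝ) ^ K)) with hX
  have hX0 : ∀ ℓ c x' y', 0 ≤ X ℓ c x' y' := fun ℓ c x' y' => mul_nonneg (abs_nonneg _) (Real.exp_nonneg _)
  have hXP : ∀ ℓ (c : Fin (K + n)) x' y', X ℓ c x' y' ≤ profileAt L (K + n) M (C * Real.exp (δ₀ / 2)) (δ₀ / 2) c (lineExp (d + 1) (κ ℓ)) x' y' :=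
    fun ℓ c x' y' => abs_sliceLine_mul_exp_le_profileAt L hL hK M hM hC hδ₀.le hδ hδ2 h37' (by have := c.isLt; omega) (κ ℓ) x' y'
  -- the finest factor
  have hθ : ((L : ℝ) ^ (n - 1) * eps L (K + n)) ^ γ = (L : ℝ) ^ (-(γ * (K + 1 : ℕ))) := by
    rw [slice_rpow_eq L hL0 (n - 1) (K + n) γ]
    congr 1
    rw [Nat.cast_sub hn]
    push_cast
    ring
  -- termwise: the decay extracted (part Α-a, weights read through the pairing)
  have hterm : ∀ j' : Fin m → Fin (K + n),
      (if ∃ ℓ, ((j' ℓ : ℕ)) < n then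
        |graphValLS ((((L : ℝ) ^ (K + n))⁻¹) ^ (d + 1)) src tgt
          (fun ℓ (x' y' : Tor (fine (L ^ (K + n)) M)) =>
            sliceLine (kingSliceKernels L (K + n) eM M hM (one_le_add_of_one_le hK n) a msq) (j' ℓ) (κ ℓ) x' y') vtx u'| else 0)
      ≤ Θ₀ * (if ∃ ℓ, ((j' ℓ : ℕ)) < n then graphValLS ((((L : ℝ) ^ (K + n))⁻¹) ^ (d + 1)) src tgt (fun ℓ => X ℓ (j' ℓ)) vtx pu else 0) := by
    intro j'
    split_ifs
    · have h := abs_graphValLS_le_of_weight ((((L : ℝ) ^ (K + n))⁻¹) ^ (d + 1)) src tgt vtx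
        (fun ℓ (x' y' : Tor (fine (L ^ (K + n)) M)) =>
          sliceLine (kingSliceKernels L (K + n) eM M hM (one_le_add_of_one_le hK n) a msq) (j' ℓ) (κ ℓ) x' y')
        (fun ℓ => X ℓ (j' ℓ))
        (fun _ x' y' => Real.exp (-(δ * (tdistT (fine (L ^ K) M) (kingSlicePt L K n M x') (kingSlicePt L K n M y') / (L : ℝ) ^ K))))
        u' pu (fun υ x' => ϑ υ (kingSlicePt L K n M x'))
        (fun ℓ x' y' => hX0 ℓ _ x' y') (fun _ _ _ => Real.exp_nonneg _) hpu0 (fun υ x' => hϑ _ _)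
        (fun ℓ x' y' => le_of_eq (by
          rw [hX, mul_assoc, ← Real.exp_add, add_neg_cancel, Real.exp_zero, mul_one]))
        hu' (fun σ' => hΘ (fun v => kingSlicePt L K n M (σ' v)))
      rw [abs_of_nonneg hw0] at h
      exact h
    · rw [mul_zero]
  refine (sum_le_sum fun j' _ => hterm j').trans ?_
  rw [← mul_sum, ← hθ]
  refine mul_le_mul_of_nonneg_left ?_ hΘ0
  exact sum_graphValLS_slices_lt_le_R L hL (by omega : 1 ≤ K + n) vtx hw0 X hX0 hC₁0 hC₂0 (((d + 1 : ℕ) : ℝ)) (fun ℓ => lineExp (d + 1) (κ ℓ))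
    (fun ℓ c x y => (hXP ℓ c x y).trans ((profileAt_le_sup L M hCe0 hδh.le _ _ x y).trans (mul_le_mul_of_nonneg_right hC₁ (hs0 c _))))
    (fun ℓ c y => (sum_le_sum fun a _ => mul_le_mul_of_nonneg_left (hXP ℓ c y a) hw0).trans
      ((lineSum_profileAt_row L hL1 M hCe0 hδh _ _ y).trans (mul_le_mul_of_nonneg_right (mul_le_mul hC₁ hC₂ (c368_pos d hδh).le hC₁0) (hs0 c _))))
    (fun ℓ c y => (sum_le_sum fun a _ => mul_le_mul_of_nonneg_left (hXP ℓ c a y) hw0).trans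
      ((lineSum_profileAt_col L hL1 M hCe0 hδh _ _ y).trans (mul_le_mul_of_nonneg_right (mul_le_mul hC₁ hC₂ (c368_pos d hδh).le hC₁0) (hs0 c _))))
    pu hpu0 υ₀ hυ₀ hΓ qq hpq cert hγ hn hpos

end PartA

/-! ## §2 The replacement step with the decay extracted, by name at `A = 0` -/

section PartB

/-- ★★★ **PROPOSITION 3.6's REPLACEMENT STEP WITH «A SMALL PART OF EACH PROPAGATOR» EXTRACTED, BY NAME AT `A = 0`** (part Η-c's
`king_graph_replacement_zeroField` × `Θ₀`).  For odd `L ≥ 3`, `a > 0`, `m₀² ≥ 0`, `0 < α < 1` there are `C, δ₁, γ > 0` (`δ₁` = HALF of Props. 3.7∕3.9's common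
rate, Ω₂ `king_props37_38_39_commonConstants`) such that for every `0 < m² ≤ m₀²`, every volume index `j`, every `n ≥ 1`, every graph shape (lines `ℓ` carrying
the slice `j_ℓ + 1 ≤ K` of kind `κ_ℓ` of King's `A = 0` propagator), every rate `0 ≤ δ ≤ δ₁`, one-vertex factors with stripped sizes `p_υ` ∕ rates `q_υ` against
POSITIVE weights `ϑ_υ` (both lattices through the pairing), and every `Θ₀` bounding `Π_ℓ exp[−δ|x_ℓ − y_ℓ|]·Π_υ ϑ_υ` at every coarse placement:
`|E^{(K+n)}(H(j)) − E^{(K)}(H(j))| ≤ Θ₀·(L^{−γK}·Σ_ℓ 𝔼^{(K)}_{C,δ₁}(H(j); ℓ at the exponent lowered by γ; p) + Σ_υ 𝔼^{(K)}_{C,δ₁}(H(j); p[υ ↦ q_υ]))` — part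
Α-c `graph_replacement_twoSpacing_decay` on the record `kingTwoSpacingFull` with Props. 3.7∕3.9 by name and part Η-c's fine sizes through the pairing.
[cite: King1986, pp.664–665 (proof of Prop. 3.6; «By extracting a small part of each propagator …»), Prop. 3.7 (3.63) p.663, Prop. 3.9 (3.73) p.665] -/
theorem king_graph_replacement_zeroField_decay (hLodd : Odd L) (hL : 2 ≤ L) {a : ℝ} (ha : 0 < a) {m0sq : ℝ} (hm0 : 0 ≤ m0sq)
    {α : ℝ} (hα0 : 0 < α) (hα1 : α < 1) :
    ∃ C δ₁ γ : ℝ, 0 < C ∧ 0 < δ₁ ∧ 0 < γ ∧ ∀ (msq : ℝ), 0 < msq → msq ≤ m0sq → ∀ (j : KingVolIndex d) (n : ℕ), 1 ≤ n →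
      ∀ (V Λ Υ : Type) [Fintype V] [DecidableEq V] [Fintype Λ] [DecidableEq Λ] [Fintype Υ] [DecidableEq Υ]
        (src tgt : Λ → V) (js : Λ → ℕ), (∀ ℓ, js ℓ + 1 ≤ j.K) → ∀ (κ : Λ → Option (Fin (d + 1))) (vtx : Υ → V) (δ : ℝ), 0 ≤ δ → δ ≤ δ₁ →
        haveI := kingVol_neZero L j
        ∀ (u : Υ → Tor (fine (L ^ j.K) (kingVol L j)) → ℝ) (u' : Υ → Tor (fine (L ^ (j.K + n)) (kingVol L j)) → ℝ)
          (ϑ p q : Υ → Tor (fine (L ^ j.K) (kingVol L j)) → ℝ),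
          (∀ υ x, 0 < ϑ υ x) → (∀ υ x, 0 ≤ p υ x) → (∀ υ x, 0 ≤ q υ x) →
          (∀ υ x, ‖u υ x‖ ≤ p υ x * ϑ υ x) → (∀ υ x', ‖u' υ x'‖ ≤ p υ (kingSlicePt L j.K n (kingVol L j) x') * ϑ υ (kingSlicePt L j.K n (kingVol L j) x')) →
          (∀ υ x', ‖u' υ x' - u υ (kingSlicePt L j.K n (kingVol L j) x')‖
              ≤ q υ (kingSlicePt L j.K n (kingVol L j) x') * ϑ υ (kingSlicePt L j.K n (kingVol L j) x')) →
          ∀ (Θ₀ : ℝ), (∀ σ : V → Tor (fine (L ^ j.K) (kingVol L j)),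
              (∏ ℓ, Real.exp (-(δ * (tdistT (fine (L ^ j.K) (kingVol L j)) (σ (src ℓ)) (σ (tgt ℓ)) / (L : ℝ) ^ j.K))))
                * ∏ υ, ϑ υ (σ (vtx υ)) ≤ Θ₀) →
          ‖graphValLS ((((L : ℝ) ^ (j.K + n))⁻¹) ^ (d + 1)) src tgt (fun ℓ => kingHiLine L a msq j n (js ℓ) (κ ℓ)) vtx u'
              - graphValLS ((((L : ℝ) ^ j.K)⁻¹) ^ (d + 1)) src tgt (fun ℓ => kingLoLine L a msq j n (js ℓ) (κ ℓ)) vtx u‖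
            ≤ Θ₀ * ((L : ℝ) ^ (-(γ * j.K))
                * ∑ ℓ, graphValLS ((((L : ℝ) ^ j.K)⁻¹) ^ (d + 1)) src tgt
                    (Function.update (fun ℓ => kingSizeProfile L a msq j n C δ₁ (js ℓ) (κ ℓ)) ℓ (kingReducedProfile L a msq j n C δ₁ γ (js ℓ) (κ ℓ)))
                    vtx p
              + ∑ υ, graphValLS ((((L : ℝ) ^ j.K)⁻¹) ^ (d + 1)) src tgt (fun ℓ => kingSizeProfile L a msq j n C δ₁ (js ℓ) (κ ℓ)) vtx
                    (Function.update p υ (q υ))) := by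
  obtain ⟨C, δ₀, γ, hC, hδ₀, hγ, H⟩ := king_props37_38_39_commonConstants (d := d) L hLodd hL ha hm0 hα0 hα1
  have hL1 : 1 ≤ L := by omega
  have hL0 : (0 : ℝ) < L := by exact_mod_cast (show 0 < L by omega)
  refine ⟨C * Real.exp δ₀, δ₀ / 2, γ, by positivity, by linarith, hγ,
    fun msq hm hcap j n hn V Λ Υ _ _ _ _ _ _ src tgt js hjs κ vtx δ hδ hδ1 u u' ϑ p q hϑ hp0 hq0 hp hp' hq Θ₀ hΘ => ?_⟩
  haveI := kingVol_neZero L j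
  obtain ⟨h37, h37', -, h39⟩ := H msq hm hcap j n hn
  letI : Fintype (kingTwoSpacingFull L a msq j n).lo.S := inferInstanceAs (Fintype (Tor (fine (L ^ j.K) (kingVol L j))))
  letI : DecidableEq (kingTwoSpacingFull L a msq j n).lo.S := inferInstanceAs (DecidableEq (Tor (fine (L ^ j.K) (kingVol L j))))
  letI : Fintype (kingTwoSpacingFull L a msq j n).hi.S := inferInstanceAs (Fintype (Tor (fine (L ^ (j.K + n)) (kingVol L j))))
  have hCe : C ≤ C * Real.exp δ₀ := le_mul_of_one_le_right hC.le (Real.one_le_exp hδ₀.le)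
  have hCe0 : 0 ≤ C * Real.exp δ₀ := by positivity
  have hdist := kingTwoSpacingFull_lodist_nonneg L a msq j n
  have h37e : Prop37PrintedAt α (kingTwoSpacingFull L a msq j n).lo (C * Real.exp δ₀) δ₀ :=
    prop37PrintedAt_mono (D := (kingTwoSpacingFull L a msq j n).lo) hL1 hdist (fun _ _ b => nomatch b) hC.le hCe le_rfl h37
  have h39e : Prop39PrintedAt α (kingTwoSpacingFull L a msq j n) (C * Real.exp δ₀) δ₀ γ :=
    prop39PrintedAt_mono (T := kingTwoSpacingFull L a msq j n) hL1 hdist (fun _ _ b => nomatch b) hC.le hCe le_rfl le_rfl h39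
  have hhi : ∀ jl : ℕ, jl + 1 ≤ (kingTwoSpacingFull L a msq j n).lo.k → ∀ (κ : Option (Fin (d + 1))) (x' y' : (kingTwoSpacingFull L a msq j n).hi.S),
      ‖hiLine (kingTwoSpacingFull L a msq j n) jl κ x' y'‖ ≤ sizeProfile (kingTwoSpacingFull L a msq j n) (C * Real.exp δ₀) δ₀ jl κ
        ((kingTwoSpacingFull L a msq j n).pt x') ((kingTwoSpacingFull L a msq j n).pt y') :=
    fun jl hjl κ x' y' => hiLine_kingTwoSpacingFull_le L hL a msq j n hC.le hδ₀.le h37' hjl κ x' y'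
  have hfib : ∀ x : (kingTwoSpacingFull L a msq j n).lo.S, (univ.filter fun x' : (kingTwoSpacingFull L a msq j n).hi.S =>
      (kingTwoSpacingFull L a msq j n).pt x' = x).card = (L ^ n) ^ (d + 1) :=
    fun x => card_filter_kingSlicePt L j.K n (kingVol L j) x
  have hw := king_weight_repair (d := d) L hL0 j.K n
  have h := graph_replacement_twoSpacing_decay (kingTwoSpacingFull L a msq j n) (show 1 ≤ L from hL1) hdist hCe0 hδ₀.le hδ1 h37e hhi h39e hfib hw
    src tgt js hjs κ vtx u u' ϑ p q hϑ hp0 hq0 hp hp' hq (Θ₀ := Θ₀) hΘ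
  have hnorm : ‖(((L : ℝ) ^ j.K)⁻¹) ^ (d + 1)‖ = (((L : ℝ) ^ j.K)⁻¹) ^ (d + 1) := Real.norm_of_nonneg (by positivity)
  rw [hnorm] at h
  exact h

end PartB

end Summit.QuantumFields.YangMills.BalabanUVNodes.N15KingModelRung.Curved

end
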